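import Summits.BirchSwinnertonDyer.BirchSwinnertonDyer.Theorems.KimAtThreeShallowEqDeepZetaBodyScaling
import HarnessLib

/-!
# Route `KimAtThreeKolyvagin` (W2): the value rows of ★ PK-6₂ WITHOUT the additive guard `p² ∣ N` —
# T-PK6-VDIS for the `p`-SCALED zeta body (good NON-ANOMALOUS / supersingular / multiplicative `p`)

Cell `bsd-addord`, seat `bsd-addord-w2-c4` (gen 8; owner of crux 19599 `ShallowEqDeepOffKatoStratum`, item
19077 `ShallowEqDeepAtTorsionFree`).  `--supports` 19599.  HONEST FRAMING: TOOL THEOREMS ONLY (no definition,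
no named fact, no instance, no `sorry`); Kato's cited matrix `ZetaBody` enters as the displayed HYPOTHESIS
`hbody` (never obtained); nothing is booked; 19599 / 19077 / 19560 stay OPEN; BSD is not proved by any of this.
Credit: the value-row machine is n1011's (cell `b2b-bsdres`, seats p02 / p13 / p15:
`ValueRow.valueRow_of_zetaBody`, `EulerFactorComparison.prod_deriv_mul_plusAvatar_sub_mem_map_span_of_zetaBody`,
`ValueRow.exists_valueRow_of_mem_map_span`), applied BY NAME and VERBATIM to the scaled body of
`KimAtThreeShallowEqDeepZetaBodyScaling.zetaBody_smul` with the scaled twist's lift / unit certificate of that file.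

## What

`valueRow_of_zetaBody_mul`: ★ PK-6₂'s value row at `(j, σ, r)` (exponent `t` on both sides) for the `p`-scaled
body (`κ ↦ p·κ`, `Λ ↦ p•Λ`, value `p • x_{0,r}`), from the ORIGINAL `hbody : ZetaBody W p f ι κ Λ c d a A z x`
and the displayed guards of T-PK6-VDIS with TWO edits: `p² ∣ N` is DROPPED, and END-m1's depletion certificate
`v_p(∏_{q∣pA}(1 − a_q/q + 𝟙_{q∤N}/q)) = 0` becomes the NON-ANOMALOUS certificate
`v_p(p · ∏_{q∣pA}(1 − a_q/q + 𝟙_{q∤N}/q)) = 0` (its `q = p` factor is `p + 𝟙_{p∤N} − a_p`: `#Ẽ(𝔽_p)` at a good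
`p`, `p ∓ 1` at a multiplicative `p`; at an additive `p` it is `p` and the certificate FAILS — that case is
n1011's original T-PK6-VDIS).  `valueRows_of_zetaBody_mul`: the `t = 0` family in ★ PK-6₂'s binder order,
i.e. LITERALLY the `hvalue` binder of the seat's unlocked port `katoKuriharaPortUnlocked_zero_of_zetaBody`
(gen 7, p475469) instantiated at the scaled body — consumed by the sequel `KimAtThreeShallowEqDeepPortNonAdd`.
HONEST LIMITS: closes nothing by itself (TOOL); books nothing; good ANOMALOUS `p` not covered.

References: K. Kato, Astérisque 295 (2004) Thm. 6.6 (1) p. 163, §6.2 p. 161, Thm. 9.7 p. 189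
[Kato2004Asterisque]; C.-H. Kim, AJM 148 (2026) = arXiv:2203.12159, §1.4.1, §3.4–3.5 and the proof of
Thm. 3.13 [Kim2022StructureSelmer]; B. Mazur, J. Tate, J. Teitelbaum, Invent. Math. 84 (1986) §I.8
[MazurTateTeitelbaum1986Invent]; K. Rubin, *Euler Systems* (2000) §4.4 [Rubin2000].
-/

noncomputable section

-- the Theorems namespace of a single-conjunct summit repeats the summit name by design (D-0017)
set_option linter.dupNamespace false

open scoped BigOperators NumberField TensorProduct
open Finset IsDedekindDomain NumberField Field WeierstrassCurve Rat.HeightOneSpectrum MonoidAlgebra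
open Literature.NumberTheory.GaloisRepresentations Literature.NumberTheory.GaloisCohomology
open Literature.NumberTheory.EllipticCurves Literature.NumberTheory.EllipticCurves.ModularForms
open Literature.NumberTheory.EllipticCurves.Kato2004
open Literature.NumberTheory.EllipticCurves.Kato2004.EulerSystemValues
open Summit.BirchSwinnertonDyer.Rank1Residual.GaloisImage
open Summit.BirchSwinnertonDyer.BirchSwinnertonDyer.Theorems.KimAtThreeShallowEqDeepZetaBodyScaling

namespace Summit.BirchSwinnertonDyer.BirchSwinnertonDyer.Theorems.KimAtThreeShallowEqDeepValueRowsNonAdd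

/-! ### T-PK6-VDIS for the `p`-scaled body: the value rows without `p² ∣ N` -/

section Main

variable {W : WeierstrassCurve ℚ} [W.IsElliptic] [W.IsGloballyMinimal] {p : ℕ} [Fact p.Prime]
  [ContinuousSMul ℤ_[p] (W.tateModule p)] [Module.Free ℤ_[p] (W.tateModule p)]
  [Module.Finite ℤ_[p] (W.tateModule p)] {N : ℕ} [NeZero N] {f : CuspForm (CongruenceSubgroup.Gamma0 N) 2}
  {ι : (m : ℕ) → (CyclotomicField m ℚ →+* ℂ)} {κ : ℝ}
  {Λ : ∀ (k : ℕ) (r : Finset (HeightOneSpectrum (𝓞 ℚ))),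
    H1 (tateRep W p) (cycSubgroup p k r) →ₗ[ℤ_[p]] ℚ_[p] ⊗[ℚ] CyclotomicField (cycLevel p k r) ℚ}
  {c d a : ℤ} {A : ℕ} [NeZero A]
  {z : ∀ (k : ℕ) (r : (cyclotomicLevelsRat p (badPlaces c d A N)).Ideals),
    H1 (tateRep W p) ((cyclotomicLevelsRat p (badPlaces c d A N)).level k r.1)}
  {x : ∀ (k : ℕ) (r : (cyclotomicLevelsRat p (badPlaces c d A N)).Ideals),
    CyclotomicField (cycLevel p k r.1) ℚ}

set_option backward.isDefEq.respectTransparency false in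
/-- **★★ THE VALUE ROW at `(j, σ, r)` for the `p`-SCALED body, WITHOUT `p² ∣ N`** — n1011's
`ValueRow.valueRow_of_zetaBody` run on `zetaBody_smul p hbody` (`κ ↦ p·κ`, `x ↦ p•x`): the twist is
`p·Vq`, lifted by `exists_padicLift_twist_mul` and certified by `isUnit_sum_coeff_twist_mul_of_certificates`
from R-κ (b) (`hNorm`, `hκ0`), the NON-ANOMALOUS depletion certificate `hE : v_p(p·∏_{q∣pA}(…)) = 0` and the 𝔊⁻
certificate `hR`; the derivative congruence (`EulerFactorComparison.…_of_zetaBody`) and T-PK6-VROW ★★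
(`ValueRow.exists_valueRow_of_mem_map_span`) are applied VERBATIM to the scaled body.  Conclusion = ★ PK-6₂'s
value row at `(j, σ, r)`, exponent `t` on both sides, for the scaled value `p • x_{0,r}`; all guards as in
T-PK6-VDIS except `p² ∣ N` (dropped).
[cite: Kim2022StructureSelmer, §1.4.1, §3.4.1–§3.5 and the proof of Thm. 3.13 (arXiv v3 pp. 7, 26–28; = Thm. 3.11 of AJM 148)]
[cite: Kato2004Asterisque, Thm. 6.6 (1) (p. 163), §6.2 (p. 161) and Thm. 9.7 (p. 189)]
[cite: MazurTateTeitelbaum1986Invent, §I.8] -/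
theorem valueRow_of_zetaBody_mul
    (hbody : ZetaBody W p f ι κ Λ c d a A z x) (hf : IsNewformOf W f) (hp2 : p ≠ 2)
    (hirr : W.HasIrreducibleModPGaloisRep p)
    (hNorm : ∃ u : ℚ, (u : ℝ) = κ ∧ padicValRat p u = 0) (hκ0 : κ ≠ 0)
    (d' : ℤ) (hcd : Int.gcd (c * d) A = 1) (hdd' : d * d' ≡ 1 [ZMOD (A : ℤ)])
    (hAN : Nat.Coprime A N)
    (aM : ℕ → ℤ) (haM : ∀ q ∈ (p * A).primeFactors, cuspCoeff f q = aM q)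
    (hE0 : ∏ q ∈ (p * A).primeFactors, (1 - (aM q : ℚ) / q + (if q ∣ N then 0 else (1 / q : ℚ))) ≠ 0)
    (hE : padicValRat p ((p : ℚ) *
      ∏ q ∈ (p * A).primeFactors, (1 - (aM q : ℚ) / q + (if q ∣ N then 0 else (1 / q : ℚ)))) = 0)
    (hR0 : (c : ℚ) ^ 2 * (d : ℚ) ^ 2 * ratMinusSymbol f ((a : ℚ) / A) -
        (c : ℚ) * (d : ℚ) ^ 2 * ratMinusSymbol f ((a * c : ℚ) / A) -
        (c : ℚ) ^ 2 * (d : ℚ) * ratMinusSymbol f ((a * d' : ℚ) / A) +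
        (c : ℚ) * (d : ℚ) * ratMinusSymbol f ((a * c * d' : ℚ) / A) ≠ 0)
    (hR : padicValRat p ((c : ℚ) ^ 2 * (d : ℚ) ^ 2 * ratMinusSymbol f ((a : ℚ) / A) -
        (c : ℚ) * (d : ℚ) ^ 2 * ratMinusSymbol f ((a * c : ℚ) / A) -
        (c : ℚ) ^ 2 * (d : ℚ) * ratMinusSymbol f ((a * d' : ℚ) / A) +
        (c : ℚ) * (d : ℚ) * ratMinusSymbol f ((a * c * d' : ℚ) / A)) = 0)
    (η : (q : HeightOneSpectrum (𝓞 ℚ)) → (ZMod (Ideal.absNorm q.asIdeal))ˣ)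
    (j t : ℕ) (σ : HeightOneSpectrum (𝓞 ℚ) → absoluteGaloisGroup ℚ)
    (hσI : ∀ q, σ q ∈ (adicCompletionPrime ℚ q).inertia (absoluteGaloisGroup ℚ))
    (hσχ : ∀ q, modNCyclotomicCharacter ℚ (Ideal.absNorm q.asIdeal) (σ q) = η q)
    (r : Finset (HeightOneSpectrum (𝓞 ℚ)))
    (hr : ∀ q ∈ r, q ∈ (cyclotomicLevelsRat p (badPlaces c d A N)).primes)
    (hKol : ∀ q ∈ r, Kato.IsKolyvaginPrime W p (j + 1) ((primesEquiv q : Nat.Primes) : ℕ))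
    (hη : ∀ q ∈ r, Subgroup.zpowers (η q) = ⊤) :
    ∃ (s : ℤ_[p]) (u : (ZMod (p ^ (j + 1)))ˣ)
      (ψ : (ℓ : ℕ) → (ZMod ℓ)ˣ →* Multiplicative (ZMod (p ^ (j + 1)))),
      (∀ q ∈ r, Function.Surjective (ψ (Ideal.absNorm q.asIdeal))) ∧
      (∃ l ∈ cycIntLattice p (cycLevel p 0 r),
        ((p : ℤ_[p]) ^ t) • ((1 : ℚ_[p]) ⊗ₜ[ℚ]
          ((r.noncommProd (fun ℓ : HeightOneSpectrum (𝓞 ℚ) =>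
              ∑ j ∈ Finset.range (((primesEquiv ℓ : Nat.Primes) : ℕ) - 1),
                (j : Module.End ℚ (CyclotomicField (cycLevel p 0 r) ℚ)) *
                  (sigma (cycLevel p 0 r) (modNCyclotomicCharacter ℚ (cycLevel p 0 r) (σ ℓ)) :
                    CyclotomicField (cycLevel p 0 r) ℚ →ₐ[ℚ]
                      CyclotomicField (cycLevel p 0 r) ℚ).toLinearMap ^ j)
            (ZetaValue.pairwise_commute_fieldDeriv (cycLevel p 0 r)
              (fun ℓ => modNCyclotomicCharacter ℚ (cycLevel p 0 r) (σ ℓ))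
              (fun ℓ => ((primesEquiv ℓ : Nat.Primes) : ℕ) - 1) r))
            ((p : ℚ) • x 0 ⟨r, hr⟩ + sigma (cycLevel p 0 r) (-1) ((p : ℚ) • x 0 ⟨r, hr⟩)))) -
          ((s : ℚ_[p]) ⊗ₜ[ℚ] (1 : CyclotomicField (cycLevel p 0 r) ℚ)) =
        ((p : ℤ_[p]) ^ (j + 1)) • (l : ℚ_[p] ⊗[ℚ] CyclotomicField (cycLevel p 0 r) ℚ)) ∧
      haveI : NeZero (∏ q ∈ r, Ideal.absNorm q.asIdeal) :=
        ⟨Finset.prod_ne_zero_iff.2 fun q _ h => q.ne_bot (Ideal.absNorm_eq_zero_iff.1 h)⟩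
      PadicInt.toZModPow (j + 1) s = (u : ZMod (p ^ (j + 1))) *
        ((p : ℕ) : ZMod (p ^ (j + 1))) ^ t *
          kuriharaNumber f (p ^ (j + 1)) (∏ q ∈ r, Ideal.absNorm q.asIdeal) ψ := by
  classical
  -- the level `n = n(r)` and its primes
  have hprim : ∀ q ∈ r, ¬ ((primesEquiv q : Nat.Primes) : ℕ) ∣ 2 * c.natAbs * d.natAbs * A * N ∧
      ((primesEquiv q : Nat.Primes) : ℕ) ≠ p := fun q hq =>
    (mem_primes_cyclotomicLevelsRat_badPlaces_iff p c d A N q).mp (hr q hq)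
  have hn : cycLevel p 0 r = ∏ q ∈ r, ((primesEquiv q : Nat.Primes) : ℕ) :=
    TameLevel.cycLevel_zero_eq_prod p r
  have hsq : Squarefree (cycLevel p 0 r) := TameLevel.squarefree_cycLevel_zero p r
  have hnN : (cycLevel p 0 r).Coprime N := by
    rw [hn]
    exact Nat.Coprime.prod_left fun q hq => (Nat.Prime.coprime_iff_not_dvd (primesEquiv q).2).mpr
      fun h => (hprim q hq).1 (dvd_mul_of_dvd_right h _)
  have hncd : (cycLevel p 0 r).Coprime (c.natAbs * d.natAbs) := by
    rw [hn]
    exact Nat.Coprime.prod_left fun q hq => (Nat.Prime.coprime_iff_not_dvd (primesEquiv q).2).mpr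
      fun h => (hprim q hq).1 (by
        obtain ⟨w, hw⟩ := h
        exact ⟨2 * A * N * w, by rw [show 2 * c.natAbs * d.natAbs * A * N =
          (c.natAbs * d.natAbs) * (2 * A * N) by ring, hw]; ring⟩)
  have hM : (p * A).Coprime (cycLevel p 0 r) := by
    rw [hn]
    refine Nat.Coprime.prod_right fun q hq => Nat.Coprime.mul_left ?_ ?_
    · exact (Nat.coprime_primes Fact.out (primesEquiv q).2).mpr (hprim q hq).2.symm
    · exact ((Nat.Prime.coprime_iff_not_dvd (primesEquiv q).2).mpr fun h =>
        (hprim q hq).1 (dvd_mul_of_dvd_left (dvd_mul_of_dvd_right h _) _)).symm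
  have hcdn : Int.gcd (c * d) (cycLevel p 0 r * A) = 1 := by
    rw [Int.gcd_eq_natAbs] at hcd ⊢
    rw [Int.natAbs_mul] at hcd ⊢
    have h2 : ((cycLevel p 0 r : ℤ) * (A : ℤ)).natAbs = cycLevel p 0 r * A := by
      rw [Int.natAbs_mul, Int.natAbs_natCast, Int.natAbs_natCast]
    rw [Int.natAbs_natCast] at hcd
    rw [h2]
    exact Nat.Coprime.mul_right hncd.symm hcd
  -- R-κ (b)
  obtain ⟨uκ, huκ, hvu⟩ := hNorm
  have huκ0 : uκ ≠ 0 := by rintro rfl; exact hκ0 (by rw [← huκ, Rat.cast_zero])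
  have huκ1 : ‖(uκ : ℚ_[p])‖ ≤ 1 := by
    rw [Padic.norm_eq_zpow_neg_valuation (by exact_mod_cast huκ0), Padic.valuation_ratCast, hvu,
      neg_zero, zpow_zero]
  have hpuκ : ((((p : ℚ) * uκ : ℚ)) : ℝ) = (p : ℝ) * κ := by push_cast; rw [huκ]
  -- the scaled body
  have hbody' := zetaBody_smul p hbody
  -- the embedding unit, the avatar of the SCALED value, the units mod `n`
  obtain ⟨u, hι⟩ := CharSum.exists_units_apply_zeta_eq_exp (cycLevel p 0 r) (ι (cycLevel p 0 r))
  obtain ⟨X, hxX, -⟩ :=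
    GroupRingEval.exists_unique_eq_sum_coeff_smul_sigma_zeta (cycLevel p 0 r) hsq ((p : ℚ) • x 0 ⟨r, hr⟩)
  have hcu : IsUnit ((c : ℤ) : ZMod (cycLevel p 0 r)) := by
    rw [ZMod.coe_int_isUnit_iff_isCoprime, Int.isCoprime_iff_gcd_eq_one, Int.gcd_eq_natAbs,
      Int.natAbs_natCast]
    exact Nat.Coprime.coprime_dvd_right (dvd_mul_right _ _) hncd
  have hdu : IsUnit ((d : ℤ) : ZMod (cycLevel p 0 r)) := by
    rw [ZMod.coe_int_isUnit_iff_isCoprime, Int.isCoprime_iff_gcd_eq_one, Int.gcd_eq_natAbs,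
      Int.natAbs_natCast]
    exact Nat.Coprime.coprime_dvd_right (dvd_mul_left _ _) hncd
  let uq : ℕ → (ZMod (cycLevel p 0 r))ˣ := fun q =>
    if h : q.Coprime (cycLevel p 0 r) then ZMod.unitOfCoprime q h else 1
  have huq : ∀ q ∈ (p * A).primeFactors,
      ((uq q : (ZMod (cycLevel p 0 r))ˣ) : ZMod (cycLevel p 0 r)) = q := by
    intro q hq
    have h : q.Coprime (cycLevel p 0 r) := Nat.Coprime.coprime_dvd_left (Nat.dvd_of_mem_primeFactors hq) hM
    simp only [uq, dif_pos h, ZMod.coe_unitOfCoprime]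
  -- Kolyvagin depth
  have hK : ∀ q ∈ r, p ^ (j + 1) ∣ ((primesEquiv q : Nat.Primes) : ℕ) - 1 := fun q hq =>
    (Nat.modEq_iff_dvd' (primesEquiv q).2.one_lt.le).mp (hKol q hq).modEq_one.symm
  -- the integral structure `Θ₀` of `θ̃_f(n)` (Stevens integrality)
  obtain ⟨Θ₀, hΘ⟩ := exists_padicLift_modularElement f p (cycLevel p 0 r) fun b => by
    have h := hf.norm_ratPlusSymbol_div_le_one hp2 hirr hnN ((b : ZMod (cycLevel p 0 r)).val : ℤ)
    rwa [Int.cast_natCast] at h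
  -- the integral lift `V` of the SCALED twist `p·Vq` (no `p`-integrality of the `q = p` Euler factor)
  have hQ := hf.coeffField_eq_bot
  have hreal : ∀ m, (cuspCoeff f m).im = 0 := cuspCoeff_im_eq_zero_of_coeffField_eq_bot hQ
  have hsymb : ∀ m : ℤ, ‖((ratMinusSymbol f ((m : ℚ) / A) : ℚ) : ℚ_[p])‖ ≤ 1 := fun m =>
    norm_ratMinusSymbol_le_one f hp2 hreal (coprime_den_of_coprime hAN m)
  have hpA0 : p * A ≠ 0 := mul_ne_zero (Fact.out : p.Prime).ne_zero (NeZero.ne A)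
  obtain ⟨V, hV⟩ := exists_padicLift_twist_mul p f u uκ (p * A) N hpA0 (dvd_mul_right p A) uq aM _ rfl
    c d a d' A hcu.unit hdu.unit _ rfl _ rfl huκ1 (hsymb a)
    (by have h := hsymb (a * c); rwa [Int.cast_mul] at h)
    (by have h := hsymb (a * d'); rwa [Int.cast_mul] at h)
    (by have h := hsymb (a * c * d'); rwa [Int.cast_mul, Int.cast_mul] at h)
  have hVu : IsUnit (∑ g : (ZMod (cycLevel p 0 r))ˣ, V.coeff g) :=
    isUnit_sum_coeff_twist_mul_of_certificates p hp2 f u uκ (p * A) N uq aM _ rfl c d a d' A hcu.unit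
      hdu.unit _ rfl _ rfl V hV huκ0 hvu hE0 hE hR0 hR
  -- PK-4b-C4b-2 (v) for the SCALED body: the derivative congruence at `b := χ_n ∘ σ`
  have hmem := EulerFactorComparison.prod_deriv_mul_plusAvatar_sub_mem_map_span_of_zetaBody
    hbody' hf hp2 hirr ⟨r, hr⟩ d' hcdn hdd' ((p : ℚ) * uκ) hpuκ u hι X hxX
    (fun q => modNCyclotomicCharacter ℚ (cycLevel p 0 r) (σ q))
    (fun q _ ℓ' hℓ' hne => ValueRow.unitsMap_modNCyclotomicCharacter_eq_one_of_mem_inertia p σ hσI r q hℓ' hne)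
    uq huq aM haM _ rfl hcu.unit hdu.unit hcu.unit_spec hdu.unit_spec _ rfl _ rfl (j + 1) hK Θ₀ hΘ V hV
  -- T-PK6-VROW ★★
  exact ValueRow.exists_valueRow_of_mem_map_span p f hp2 hf hirr j t σ η hσI hσχ r hη hKol
    ((p : ℚ) • x 0 ⟨r, hr⟩) X hxX Θ₀ hΘ V hVu hmem

set_option backward.isDefEq.respectTransparency false in
/-- **★ PK-6₂'s binder (e) `hvalue` for the `p`-SCALED body, DISCHARGED without `p² ∣ N`** — the value
rows at every depth `j`, every admissible datum and every usable Kolyvagin level, in the literal binder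
order of `katoKuriharaPortThreeAtWith₂_zero_of_zetaBody` / the seat's unlocked twin (`t = 0`), for the body
`zetaBody_smul p hbody` (value `p • x_{0,r}`), from the displayed hypotheses of `valueRow_of_zetaBody_mul`.
[cite: Kim2022StructureSelmer, the proof of Thm. 3.13 (arXiv v3 pp. 26–28; = Thm. 3.11 of AJM 148)]
[cite: Kato2004Asterisque, Thm. 6.6 (1) (p. 163) and Thm. 9.7 (p. 189)] -/
theorem valueRows_of_zetaBody_mul
    (hbody : ZetaBody W p f ι κ Λ c d a A z x) (hf : IsNewformOf W f) (hp2 : p ≠ 2)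
    (hirr : W.HasIrreducibleModPGaloisRep p)
    (hNorm : ∃ u : ℚ, (u : ℝ) = κ ∧ padicValRat p u = 0) (hκ0 : κ ≠ 0)
    (d' : ℤ) (hcd : Int.gcd (c * d) A = 1) (hdd' : d * d' ≡ 1 [ZMOD (A : ℤ)])
    (hAN : Nat.Coprime A N)
    (aM : ℕ → ℤ) (haM : ∀ q ∈ (p * A).primeFactors, cuspCoeff f q = aM q)
    (hE0 : ∏ q ∈ (p * A).primeFactors, (1 - (aM q : ℚ) / q + (if q ∣ N then 0 else (1 / q : ℚ))) ≠ 0)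
    (hE : padicValRat p ((p : ℚ) *
      ∏ q ∈ (p * A).primeFactors, (1 - (aM q : ℚ) / q + (if q ∣ N then 0 else (1 / q : ℚ)))) = 0)
    (hR0 : (c : ℚ) ^ 2 * (d : ℚ) ^ 2 * ratMinusSymbol f ((a : ℚ) / A) -
        (c : ℚ) * (d : ℚ) ^ 2 * ratMinusSymbol f ((a * c : ℚ) / A) -
        (c : ℚ) ^ 2 * (d : ℚ) * ratMinusSymbol f ((a * d' : ℚ) / A) +
        (c : ℚ) * (d : ℚ) * ratMinusSymbol f ((a * c * d' : ℚ) / A) ≠ 0)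
    (hR : padicValRat p ((c : ℚ) ^ 2 * (d : ℚ) ^ 2 * ratMinusSymbol f ((a : ℚ) / A) -
        (c : ℚ) * (d : ℚ) ^ 2 * ratMinusSymbol f ((a * c : ℚ) / A) -
        (c : ℚ) ^ 2 * (d : ℚ) * ratMinusSymbol f ((a * d' : ℚ) / A) +
        (c : ℚ) * (d : ℚ) * ratMinusSymbol f ((a * c * d' : ℚ) / A)) = 0)
    (η : (q : HeightOneSpectrum (𝓞 ℚ)) → (ZMod (Ideal.absNorm q.asIdeal))ˣ) :
    ∀ (j : ℕ) (σ : HeightOneSpectrum (𝓞 ℚ) → absoluteGaloisGroup ℚ),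
      (∀ q, σ q ∈ (adicCompletionPrime ℚ q).inertia (absoluteGaloisGroup ℚ)) →
      (∀ q, modNCyclotomicCharacter ℚ (Ideal.absNorm q.asIdeal) (σ q) = η q) →
      ∀ (r : Finset (HeightOneSpectrum (𝓞 ℚ)))
        (hr : ∀ q ∈ r, q ∈ (cyclotomicLevelsRat p (badPlaces c d A N)).primes),
        (∀ q ∈ r, Kato.IsKolyvaginPrime W p (j + 1) ((primesEquiv q : Nat.Primes) : ℕ)) →
        (∀ q ∈ r, Subgroup.zpowers (η q) = ⊤) →
        ∃ (s : ℤ_[p]) (u : (ZMod (p ^ (j + 1)))ˣ)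
          (ψ : (ℓ : ℕ) → (ZMod ℓ)ˣ →* Multiplicative (ZMod (p ^ (j + 1)))),
          (∀ q ∈ r, Function.Surjective (ψ (Ideal.absNorm q.asIdeal))) ∧
          (∃ l ∈ cycIntLattice p (cycLevel p 0 r),
            (((p : ℕ) : ℤ_[p]) ^ (0 : ℕ)) • ((1 : ℚ_[p]) ⊗ₜ[ℚ]
              ((r.noncommProd (fun ℓ : HeightOneSpectrum (𝓞 ℚ) =>
                  ∑ j ∈ Finset.range (((primesEquiv ℓ : Nat.Primes) : ℕ) - 1),
                    (j : Module.End ℚ (CyclotomicField (cycLevel p 0 r) ℚ)) *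
                      (sigma (cycLevel p 0 r) (modNCyclotomicCharacter ℚ (cycLevel p 0 r) (σ ℓ)) :
                        CyclotomicField (cycLevel p 0 r) ℚ →ₐ[ℚ]
                          CyclotomicField (cycLevel p 0 r) ℚ).toLinearMap ^ j)
                (ZetaValue.pairwise_commute_fieldDeriv (cycLevel p 0 r)
                  (fun ℓ => modNCyclotomicCharacter ℚ (cycLevel p 0 r) (σ ℓ))
                  (fun ℓ => ((primesEquiv ℓ : Nat.Primes) : ℕ) - 1) r))
                ((p : ℚ) • x 0 ⟨r, hr⟩ + sigma (cycLevel p 0 r) (-1) ((p : ℚ) • x 0 ⟨r, hr⟩)))) -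
              ((s : ℚ_[p]) ⊗ₜ[ℚ] (1 : CyclotomicField (cycLevel p 0 r) ℚ)) =
            (((p : ℕ) : ℤ_[p]) ^ (j + 1)) • (l : ℚ_[p] ⊗[ℚ] CyclotomicField (cycLevel p 0 r) ℚ)) ∧
          haveI : NeZero (∏ q ∈ r, Ideal.absNorm q.asIdeal) :=
            ⟨Finset.prod_ne_zero_iff.2 fun q _ h => q.ne_bot (Ideal.absNorm_eq_zero_iff.1 h)⟩
          PadicInt.toZModPow (j + 1) s = (u : ZMod (p ^ (j + 1))) *
            ((p : ℕ) : ZMod (p ^ (j + 1))) ^ (0 : ℕ) *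
              kuriharaNumber f (p ^ (j + 1)) (∏ q ∈ r, Ideal.absNorm q.asIdeal) ψ :=
  fun j σ hσI hσχ r hr hKol hη =>
    valueRow_of_zetaBody_mul hbody hf hp2 hirr hNorm hκ0 d' hcd hdd' hAN aM haM hE0 hE hR0 hR η j 0 σ
      hσI hσχ r hr hKol hη

end Main

end Summit.BirchSwinnertonDyer.BirchSwinnertonDyer.Theorems.KimAtThreeShallowEqDeepValueRowsNonAdd

end
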